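import Mathlib.Analysis.SpecialFunctions.Pow.NNReal
import Literature.NumberTheory.EllipticCurves.PastenValuationProduct
import Literature.NumberTheory.EllipticCurves.KodairaNeronLeFourProofs
import Literature.NumberTheory.EllipticCurves.KodairaNeronSplitCyclicProofs
import Literature.NumberTheory.EllipticCurves.TamagawaRingEquivProofs
import Literature.NumberTheory.EllipticCurves.RootNumberProofs
import Literature.NumberTheory.EllipticCurves.ShafarevichGoodReductionProofs
import Literature.NumberTheory.DiophantineGeometry.ConductorRingOfIntegersProofs
import Literature.NumberTheory.DiophantineGeometry.ConductorFactorizationProofs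
import Literature.NumberTheory.DiophantineGeometry.ConductorExponentZeroProofs
import Literature.NumberTheory.DiophantineGeometry.MinimalDiscriminantProofs
import Literature.NumberTheory.DiophantineGeometry.MinimalDiscriminantFactorizationProofs
import Literature.NumberTheory.DiophantineGeometry.LocalReductionProofs
import Literature.RingTheory.DiscreteValuationRing.AdicCompletionHensel
import HarnessLib

/-!
# Pasten's bound for the Tamagawa product: Theorem 1.15 from Corollary 16.2 (proofs)

Topic `NumberTheory/EllipticCurves`; namespace `Literature.NumberTheory.EllipticCurves`.
Sibling *proofs* file (theorems only: no definition, no named fact, no instance) of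
`Literature.NumberTheory.EllipticCurves.PastenValuationProduct`.  It proves the reduction

* `Literature.NumberTheory.EllipticCurves.pasten_thm_1_15_of_cor_16_2 :
    pasten_cor_16_2 → pasten_thm_1_15`,

i.e. H. Pasten, *Shimura curves and the abc conjecture*, J. Number Theory 254 (2024) =
arXiv:1705.09251, Theorem 1.15 (PDF p. 8 of the arXiv version) — `Tam(E) < K_{S,ε} · N_E^{11/2+ε}`
for every `E/ℚ` semi-stable away from `S` with at least two primes of multiplicative reduction —
*from* the named fact `pasten_cor_16_2` (Corollary 16.2, PDF pp. 49–50, the product-of-valuations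
estimate coming from the Shimura-curve theory of the paper — Theorem 16.1: Shimura-curve
parametrisations `X_0^D(M) → E`, Jacquet–Langlands and modularity, the refined Ribet–Takahashi
formula, Arakelov bounds — which is not in the tree and is NOT discharged here), following the
printed proof of Corollary 16.3 (PDF p. 50):

> "This follows from Corollary 16.2. In fact, given an elliptic curve `E` over `ℚ`, if `E` has
> additive or non-split multiplicative reduction at a prime `p` then `Tam_p(E) ≤ 4`, so
> `Tam(E) ≤ 4^{ω(N_E)} ∏_{p ∣ N_E^*} v_p(Δ_E) ≪_ε N_E^ε ∏_{p ∣ N_E^*} v_p(Δ_E)`."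

and absorbing the finitely many exceptional curves of Corollary 16.3 ("all but finitely many",
rendered in `pasten_cor_16_2` as `N_E ≥ N₀(S, ε)`) into the constant, as Theorem 1.15 does: by
Shafarevich's theorem there are only finitely many `E/ℚ` of conductor `< N₀` up to
`ℚ`-isomorphism, and `Tam` is an isomorphism invariant.

**History of the path.** These theorems were first landed at
`Literature/NumberTheory/EllipticCurves/PastenValuationProductProofs.lean` (ledger p41492, p42293);
that shared path was afterwards overwritten by whole-file submissions of other units working on
other facts of `PastenValuationProduct.lean` and now only indexes the per-topic siblings (see its
module docstring), so the theorems are re-landed here verbatim. The seven general lemmas that the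
sibling `PastenValuationProductTamagawaProofs.lean` (the `pasten_thm_1_15_semistable` side) has
meanwhile re-landed under the same names (`localTamagawaNumber_le_max_four_ordMinimalDiscriminant`,
`localTamagawaNumber_eq_one_of_ordMinimalDiscriminant_eq_zero`, `primeFactors_conductorNorm_eq`,
`tamagawaProduct_le_prod_primeFactors`, `tamagawaProduct_le_four_pow_mul_prod`,
`ordMinimalDiscriminant_eq_of_primesEquiv_eq`, `ordMinimalDiscriminant_ringOfIntegers_eq_factorization`)
together with its `exists_four_pow_card_primeFactors_le` (`4^{ω(n)} ≪_δ n^δ`) and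
`pasten_thm_1_15_semistable_of_thm_1_12`, are NOT repeated here; nor is that sibling imported (its
import closure contains `PastenValuationProductSemistableProofs.lean`, which shares a declaration
name with `PastenCor162Proofs.lean`, the home of the `pasten_cor_16_2` dictionary — keeping this
file's imports to the modules its proofs use leaves it importable next to either).

## The steps and their inputs (all proved in the tree)

* **Kodaira–Néron over `ℤ_p`** (`localTamagawaNumber_padic_le_four`,
  `localTamagawaNumber_padic_eq_of_split`): `c_p ≤ 4` unless the reduction is split
  multiplicative, and `c_p = ord_p(Δ_min)` in the split case —
  `WeierstrassCurve.index_goodReductionSubgroup_le_four_holds` (Silverman *ATAEC* IV.9.2(d)),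
  `WeierstrassCurve.index_goodReductionSubgroup_of_hasSplitMultiplicativeReduction_holds`
  (`ℤ_p` is Henselian: Mathlib's `IsAdicComplete (maximalIdeal ℤ_[p]) ℤ_[p]`; its residue field
  `𝔽_p` is finite hence perfect), and `c_p = 1` at good primes
  (`WeierstrassCurve.localTamagawaNumber_eq_one_of_hasGoodReduction_holds`).
* **Dictionary** between the factors `c_v` of `WeierstrassCurve.tamagawaProduct` (indexed by the
  finite places of `𝓞 ℚ`), the `p`-adic numbers `c(E/ℚ_p)`, and the places of `ℤ` indexing the
  hypotheses of the statements: `WeierstrassCurve.localTamagawaNumber_padic_eq_holds`,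
  `WeierstrassCurve.hasGoodReductionAtPrime_primesEquiv_iff_hasGoodReductionAt`,
  `WeierstrassCurve.hasMultiplicativeReductionAtPrime_primesEquiv_iff_hasMultiplicativeReductionAt`,
  `WeierstrassCurve.ordMinimalDiscriminant_eq_padic` (all along `ℚ_v ≃ ℚ_[p]`).
* **Conductor support**: the bad primes divide `N_E`
  (`WeierstrassCurve.conductorExponent_eq_zero_iff_holds`, Silverman *ATAEC* IV.10.2(a), with
  `WeierstrassCurve.factorization_conductorNorm_holds`), so `#{bad places} ≤ ω(N_E)`; and
  `ord_v(Δ_min) ≥ 1` at bad `v` (`WeierstrassCurve.ordMinimalDiscriminant_eq_zero_iff_holds`).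
* **`4^{ω(N)} ≪_δ N^δ`** (elementary: primes `≥ 4^{1/δ}` contribute `p^δ ≥ 4` each, the
  others at most `4^{⌈4^{1/δ}⌉}` in total), proved inline in the assembly (the same statement is
  `exists_four_pow_card_primeFactors_le` of `PastenValuationProductTamagawaProofs.lean`).
* **Finiteness for bounded conductor** (`exists_tamagawaProduct_le_of_conductorNorm_lt`):
  Shafarevich's theorem `WeierstrassCurve.shafarevich_finite_goodReductionOutside_holds`
  (Silverman *AEC* IX.6.1) with the invariance `WeierstrassCurve.tamagawaProduct_variableChange_eq`.

Also recorded, for reuse: the Kodaira–Néron estimate over an arbitrary discrete valuation ring with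
perfect residue field (`localTamagawaNumber_le_four_of_not_hasSplitMultiplicativeReduction`,
`localTamagawaNumber_eq_toNat_addVal_of_hasSplitMultiplicativeReduction`), the place-by-place
toolkit over `ℤ` (`localTamagawaNumber_padic_le_four_mul`, `localTamagawaNumber_padic_le_max`,
`tamagawaProduct_eq_finprod_int`, `tamagawaProduct_eq_prod`, `tamagawaProduct_le_prod`,
`tamagawaProduct_le_four_pow_mul_finprod` : `Tam(E) ≤ 4^{ω(N_E)} ∏_{v mult} ord_v(Δ_min)` — the
displayed inequality of the proof of Cor. 16.3 with `N_E^*`), and the dictionary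
`finprod_ordMinimalDiscriminant_eq_prod_factorization` between the product over the multiplicative
places of `pasten_cor_16_2` and the product `∏_{p ∣ N_E} v_p(Δ_E)` of `pasten_thm_1_12` for
semistable `E`.

Assembly (`pasten_thm_1_15_of_cor_16_2`): apply Corollary 16.2 with `ε/2`; for `N_E ≥ N₀`,
`Tam(E) ≤ 4^{ω(N_E)} ∏_{v mult} ord_v(Δ_min) < C_ε N_E^{ε/2} · N_E^{11/2+ε/2}`; for `N_E < N₀`,
`Tam(E) ≤ K₁(S, ε)`; take `K = K₁ + C_ε + 1`. Once `pasten_cor_16_2` is discharged (equivalently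
`DiophantineGeometry.pasten_valuationProduct_awayFrom` or `DiophantineGeometry.pastenShimura2024_cor_16_2`,
cf. `PastenCor162Proofs.lean`; all three reduce to Theorem 16.1 by
`DiophantineGeometry.pasten_valuationProduct_awayFrom_of_thm16_1`), the discharge is the one-liner
`theorem pasten_thm_1_15_holds : pasten_thm_1_15 := pasten_thm_1_15_of_cor_16_2 pasten_cor_16_2_holds`.

## References

* [PastenShimura2024] H. Pasten, *Shimura curves and the abc conjecture*, J. Number Theory 254
  (2024) 214–335, doi:10.1016/j.jnt.2023.07.002, arXiv:1705.09251 — Thm 1.15 (p. 8),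
  Cor 16.2, Cor 16.3 (pp. 49–50).
* [SilvermanATAEC1994] J. H. Silverman, *Advanced Topics in the Arithmetic of Elliptic Curves*,
  GTM 151, Cor. IV.9.2(d) (Kodaira–Néron), IV.10.2.
* [SilvermanAEC2009] J. H. Silverman, *The Arithmetic of Elliptic Curves*, 2nd ed., Thm. IX.6.1
  (Shafarevich).
-/
noncomputable section

open scoped Classical

namespace Literature.NumberTheory.EllipticCurves

open _root_.IsDedekindDomain _root_.NumberField _root_.WeierstrassCurve _root_.Rat.HeightOneSpectrum

/-! ### Kodaira–Néron over a discrete valuation ring -/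

section DVR

variable (R : Type*) [CommRing R] [IsDomain R] [IsDiscreteValuationRing R] {L : Type*} [Field L]
  [Algebra R L] [IsFractionRing R L] [PerfectField (IsLocalRing.ResidueField R)]
  (X : WeierstrassCurve L) [X.IsElliptic]

/-- **Kodaira–Néron, the bound `4`** (Silverman, *ATAEC* Cor. IV.9.2(d); the sentence "if `E`
has additive or non-split multiplicative reduction at a prime `p` then `Tam_p(E) ≤ 4`" of
[PastenShimura2024, proof of Cor. 16.3]), for the local Tamagawa number of `Tamagawa.lean`:
over a discrete valuation ring with perfect residue field, unless the chosen minimal model of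
`X` has split multiplicative reduction, `c(X) = [X(L) : X₀(L)] ≤ 4`
(`WeierstrassCurve.index_goodReductionSubgroup_le_four_holds` on `X.minimal R`).
[cite: SilvermanATAEC1994, Cor. IV.9.2(d) (PDF p. 340)] -/
theorem localTamagawaNumber_le_four_of_not_hasSplitMultiplicativeReduction
    (h : ¬ (X.minimal R).HasSplitMultiplicativeReduction R) :
    X.localTamagawaNumber R ≤ 4 := by
  haveI : (X.minimal R).IsElliptic := by rw [WeierstrassCurve.minimal]; infer_instance
  exact ((X.minimal R).index_goodReductionSubgroup_le_four_holds R h).2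

/-- **Kodaira–Néron, split multiplicative reduction** (Silverman, *ATAEC* Cor. IV.9.2(d) with
(b), over a *Henselian* discrete valuation ring with perfect residue field): if the chosen minimal
model of `X` has split multiplicative reduction then `c(X) = v(Δ_min)`, the order of the
discriminant of its integral model
(`WeierstrassCurve.index_goodReductionSubgroup_of_hasSplitMultiplicativeReduction_holds`, read
through `WeierstrassCurve.valuation_Δ_eq_addVal`).
[cite: SilvermanATAEC1994, Cor. IV.9.2(d) with (b) (PDF p. 340)] -/
theorem localTamagawaNumber_eq_toNat_addVal_of_hasSplitMultiplicativeReduction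
    [HenselianRing R (IsLocalRing.maximalIdeal R)]
    (h : (X.minimal R).HasSplitMultiplicativeReduction R) :
    X.localTamagawaNumber R =
      (IsDiscreteValuationRing.addVal R ((X.minimal R).integralModel R).Δ).toNat := by
  haveI : (X.minimal R).IsElliptic := by rw [WeierstrassCurve.minimal]; infer_instance
  haveI := h
  have hval :=
    ((X.minimal R).index_goodReductionSubgroup_of_hasSplitMultiplicativeReduction_holds R).2
  rw [valuation_Δ_eq_addVal] at hval
  change ((X.minimal R).goodReductionSubgroup R).index = _
  generalize ((X.minimal R).goodReductionSubgroup R).index = c at hval ⊢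
  generalize IsDiscreteValuationRing.addVal R ((X.minimal R).integralModel R).Δ = a at hval ⊢
  induction a using ENat.recTopCoe with
  | top =>
    exfalso
    simp only [ENat.recTopCoe_top, inv_zero] at hval
    exact WithZero.exp_ne_zero hval.symm
  | coe n =>
    simp only [ENat.recTopCoe_coe, ENat.toNat_coe] at hval ⊢
    have h' : WithZero.exp (-(n : ℤ)) = WithZero.exp (-(c : ℤ)) := hval
    simpa using h'.symm

end DVR

/-! ### Kodaira–Néron over `ℤ_p` -/

section Padic

variable (p : ℕ) [Fact p.Prime] (X : WeierstrassCurve ℚ_[p]) [X.IsElliptic]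

omit [Fact p.Prime] in
/-- The residue field of `ℤ_[p]` is finite (`ℤ_[p]/(p) ≃ 𝔽_p`, Mathlib `PadicInt.residueField`);
in particular it is perfect (`PerfectField.ofFinite`), as Tate's algorithm requires. [folklore] -/
theorem finite_residueField_padicInt [Fact p.Prime] : Finite (IsLocalRing.ResidueField ℤ_[p]) :=
  Finite.of_equiv (ZMod p) (PadicInt.residueField (p := p)).symm.toEquiv

/-- **Kodaira–Néron, the bound `4`** over `ℚ_p` (Silverman, *ATAEC* Cor. IV.9.2(d); the sentence
"if `E` has additive or non-split multiplicative reduction at a prime `p` then `Tam_p(E) ≤ 4`" of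
[PastenShimura2024, proof of Cor. 16.3]): unless the minimal model of `X / ℚ_p` has split
multiplicative reduction, `c(X/ℚ_p) = [X(ℚ_p) : X₀(ℚ_p)] ≤ 4`.
[cite: SilvermanATAEC1994, Cor. IV.9.2(d) (PDF p. 340)] -/
theorem localTamagawaNumber_padic_le_four
    (h : ¬ (X.minimal ℤ_[p]).HasSplitMultiplicativeReduction ℤ_[p]) :
    X.localTamagawaNumber ℤ_[p] ≤ 4 := by
  haveI := finite_residueField_padicInt p
  exact localTamagawaNumber_le_four_of_not_hasSplitMultiplicativeReduction ℤ_[p] X h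

/-- **Kodaira–Néron, split multiplicative reduction** over `ℚ_p` (Silverman, *ATAEC*
Cor. IV.9.2(d) with (b): `ℤ_p` is complete, hence Henselian): if the minimal model of `X / ℚ_p`
has split multiplicative reduction then `c(X/ℚ_p) = ord_p(Δ_min)`, the `p`-adic order of the
discriminant of the (integral) minimal model.
[cite: SilvermanATAEC1994, Cor. IV.9.2(d) with (b) (PDF p. 340)] -/
theorem localTamagawaNumber_padic_eq_of_split
    (h : (X.minimal ℤ_[p]).HasSplitMultiplicativeReduction ℤ_[p]) :
    X.localTamagawaNumber ℤ_[p] =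
      (IsDiscreteValuationRing.addVal ℤ_[p] ((X.minimal ℤ_[p]).integralModel ℤ_[p]).Δ).toNat := by
  haveI := finite_residueField_padicInt p
  exact localTamagawaNumber_eq_toNat_addVal_of_hasSplitMultiplicativeReduction ℤ_[p] X h

end Padic

/-! ### The local factors of `Tam(E)` at the places of `ℤ` -/

section Places

variable (W : WeierstrassCurve ℚ) [W.IsElliptic]

omit [W.IsElliptic] in
/-- `c_p = 1` at a prime of good reduction (Silverman, *AEC* VII.2, remark after Prop. 2.1;
Tate's algorithm Step 1), in `p`-adic form at the place `v` of `ℤ`: transport the good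
reduction of the chosen `𝓞_v`-minimal model to the `ℤ_p`-minimal model of `W / ℚ_p`
(`hasGoodReductionAtPrime_primesEquiv_iff_hasGoodReductionAt`) and apply
`localTamagawaNumber_eq_one_of_hasGoodReduction_holds`. [folklore] -/
theorem localTamagawaNumber_padic_eq_one_of_hasGoodReductionAt (v : HeightOneSpectrum ℤ)
    (h : W.HasGoodReductionAt v) :
    (haveI := Fact.mk (primesEquiv v).2
     (W.baseChange ℚ_[primesEquiv v]).localTamagawaNumber ℤ_[primesEquiv v]) = 1 := by
  haveI := Fact.mk (primesEquiv v).2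
  have hg : W.HasGoodReductionAtPrime (primesEquiv v) :=
    (hasGoodReductionAtPrime_primesEquiv_iff_hasGoodReductionAt W v).mpr h
  haveI : ((W.baseChange ℚ_[primesEquiv v]).minimal ℤ_[primesEquiv v]).HasGoodReduction
      ℤ_[primesEquiv v] := hg
  exact localTamagawaNumber_eq_one_of_hasGoodReduction_holds ℤ_[primesEquiv v] _

/-- **The local estimate of [PastenShimura2024, proof of Cor. 16.3]**, place by place: for every
finite place `v` of `ℤ` (prime `p`), `c_p ≤ 4 · ord_v(Δ_min)` if `E` has multiplicative reduction
at `v` and `c_p ≤ 4` otherwise (Kodaira–Néron: `c_p = ord_p(Δ_min)` if split multiplicative,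
`c_p ≤ 4` otherwise, and `ord_v(Δ_min) ≥ 1` at a bad place).
[cite: PastenShimura2024, proof of Corollary 16.3] -/
theorem localTamagawaNumber_padic_le_four_mul (v : HeightOneSpectrum ℤ) :
    (haveI := Fact.mk (primesEquiv v).2
     (W.baseChange ℚ_[primesEquiv v]).localTamagawaNumber ℤ_[primesEquiv v]) ≤
      4 * (if W.HasMultiplicativeReductionAt v then W.ordMinimalDiscriminant v else 1) := by
  haveI := Fact.mk (primesEquiv v).2
  haveI : (W.baseChange ℚ_[primesEquiv v]).IsElliptic := by
    unfold WeierstrassCurve.baseChange; infer_instance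
  by_cases hs : ((W.baseChange ℚ_[primesEquiv v]).minimal ℤ_[primesEquiv v])
      |>.HasSplitMultiplicativeReduction ℤ_[primesEquiv v]
  · -- split multiplicative: `c_p = ord_v(Δ_min)`
    have hm : W.HasMultiplicativeReductionAt v :=
      (hasMultiplicativeReductionAtPrime_primesEquiv_iff_hasMultiplicativeReductionAt W v).mp
        hs.toHasMultiplicativeReduction
    rw [if_pos hm, localTamagawaNumber_padic_eq_of_split _ _ hs, ← ordMinimalDiscriminant_eq_padic v W]
    omega
  · -- not split multiplicative: `c_p ≤ 4`
    have h4 := localTamagawaNumber_padic_le_four _ _ hs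
    have h1 : 1 ≤ (if W.HasMultiplicativeReductionAt v then W.ordMinimalDiscriminant v else 1) := by
      split_ifs with hm
      · refine Nat.one_le_iff_ne_zero.mpr fun h0 => hm.not_hasGoodReductionAt ?_
        exact (ordMinimalDiscriminant_eq_zero_iff_holds v W).mp h0
      · exact le_rfl
    calc _ ≤ 4 := h4
      _ = 4 * 1 := rfl
      _ ≤ _ := Nat.mul_le_mul_left 4 h1

/-- A bad prime divides the conductor: if `W / ℚ` does not have good reduction at the place `v`
of `ℤ`, then `f_v ≠ 0` (Silverman *ATAEC* IV.10.2(a), `conductorExponent_eq_zero_iff_holds`), so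
the prime `p_v` lies in the support of `N_E = ∏_p p^{f_p}` (`factorization_conductorNorm_holds`).
[cite: SilvermanATAEC1994, IV.10.2(a)] -/
theorem natGenerator_mem_primeFactors_conductorNorm (v : HeightOneSpectrum ℤ)
    (h : ¬ W.HasGoodReductionAt v) :
    natGenerator v ∈ (W.conductorNorm ℤ).primeFactors := by
  have hf : W.conductorExponent v ≠ 0 := fun h0 =>
    h ((conductorExponent_eq_zero_iff_holds v W).mp h0)
  have hfac : (W.conductorNorm ℤ).factorization (natGenerator v) = W.conductorExponent v :=
    factorization_conductorNorm_holds W v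
  rw [← Nat.support_factorization, Finsupp.mem_support_iff, hfac]
  exact hf

/-- The bad primes of `E/ℚ` are exactly the prime factors of the conductor: `v ↦ p_v` maps any
finite set of places of `ℤ` consisting of the bad places onto `N_E.primeFactors`
(`f_v = 0 ↔` good reduction, Silverman *ATAEC* IV.10.2(a)). [cite: SilvermanATAEC1994, IV.10.2(a)] -/
theorem image_natGenerator_eq_primeFactors_conductorNorm (s : Finset (HeightOneSpectrum ℤ))
    (hs : ∀ v, v ∈ s ↔ ¬ W.HasGoodReductionAt v) :
    s.image (fun v => natGenerator v) = (W.conductorNorm ℤ).primeFactors := by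
  ext p
  simp only [Finset.mem_image]
  constructor
  · rintro ⟨v, hv, rfl⟩
    exact natGenerator_mem_primeFactors_conductorNorm W v ((hs v).mp hv)
  · intro hp
    have hp' : p.Prime := Nat.prime_of_mem_primeFactors hp
    have hgen : natGenerator ((primesEquiv (R := ℤ)).symm ⟨p, hp'⟩) = p :=
      congrArg Subtype.val ((primesEquiv (R := ℤ)).apply_symm_apply ⟨p, hp'⟩)
    refine ⟨(primesEquiv (R := ℤ)).symm ⟨p, hp'⟩, (hs _).mpr fun hg => ?_, hgen⟩
    -- good reduction at the place over `p` would give `f_p = 0`, i.e. `p ∤ N_E`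
    have h0 : W.conductorExponent ((primesEquiv (R := ℤ)).symm ⟨p, hp'⟩) = 0 :=
      (conductorExponent_eq_zero_iff_holds _ W).mpr hg
    have hfac : (W.conductorNorm ℤ).factorization
        (natGenerator ((primesEquiv (R := ℤ)).symm ⟨p, hp'⟩)) =
          W.conductorExponent ((primesEquiv (R := ℤ)).symm ⟨p, hp'⟩) :=
      factorization_conductorNorm_holds W _
    rw [hgen, h0] at hfac
    rw [← Nat.support_factorization, Finsupp.mem_support_iff] at hp
    exact hp hfac

/-- **Kodaira–Néron, `p`-adic form at a place of `ℤ`**: `c_p ≤ max(4, ord_v(Δ_min))` for the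
`p`-adic local Tamagawa number of `W / ℚ` at the prime `p` below `v`
(`localTamagawaNumber_padic_le_four`, `localTamagawaNumber_padic_eq_of_split` and
`ordMinimalDiscriminant_eq_padic`). [cite: SilvermanATAEC1994, Cor. IV.9.2(d) (PDF p. 340)] -/
theorem localTamagawaNumber_padic_le_max (v : HeightOneSpectrum ℤ) :
    (haveI := Fact.mk (primesEquiv v).2
     (W.baseChange ℚ_[primesEquiv v]).localTamagawaNumber ℤ_[primesEquiv v]) ≤
      max 4 (W.ordMinimalDiscriminant v) := by
  haveI := Fact.mk (primesEquiv v).2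
  haveI : (W.baseChange ℚ_[primesEquiv v]).IsElliptic := by
    unfold WeierstrassCurve.baseChange; infer_instance
  by_cases hs : ((W.baseChange ℚ_[primesEquiv v]).minimal ℤ_[primesEquiv v])
      |>.HasSplitMultiplicativeReduction ℤ_[primesEquiv v]
  · rw [localTamagawaNumber_padic_eq_of_split _ _ hs, ← ordMinimalDiscriminant_eq_padic v W]
    exact le_max_right _ _
  · exact (localTamagawaNumber_padic_le_four _ _ hs).trans (le_max_left _ _)

/-- **`Tam(E)` over the places of `ℤ`.** The Tamagawa product `∏ᶠ_v c_v` of `W / ℚ` (a `finprod`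
over the finite places of `𝓞 ℚ`, each factor computed over `𝓞_v ⊆ ℚ_v`) equals the `finprod`
over the places `v` of `ℤ` of the `p`-adic local Tamagawa numbers `c(W/ℚ_p)`, `p` the prime below
`v` (reindex along `HeightOneSpectrum ℤ ≃ Nat.Primes ≃ HeightOneSpectrum (𝓞 ℚ)` and use
`localTamagawaNumber_padic_eq_holds`). [folklore] -/
theorem tamagawaProduct_eq_finprod_int :
    W.tamagawaProduct = ∏ᶠ v : HeightOneSpectrum ℤ,
      (haveI := Fact.mk (primesEquiv v).2
       (W.baseChange ℚ_[primesEquiv v]).localTamagawaNumber ℤ_[primesEquiv v]) := by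
  have hre := finprod_comp_equiv ((primesEquiv (R := ℤ)).trans (primesEquiv (R := 𝓞 ℚ)).symm)
    (f := fun w : HeightOneSpectrum (𝓞 ℚ) =>
      (W.baseChange (w.adicCompletion ℚ)).localTamagawaNumber (w.adicCompletionIntegers ℚ))
  unfold WeierstrassCurve.tamagawaProduct
  rw [← hre]
  refine finprod_congr fun v => ?_
  haveI := Fact.mk (primesEquiv v).2
  simp only [Equiv.trans_apply]
  exact (localTamagawaNumber_padic_eq_holds W ((primesEquiv (R := 𝓞 ℚ)).symm (primesEquiv v))
    (primesEquiv v : ℕ) (by rw [Equiv.apply_symm_apply])).symm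

/-- `Tam(E)` is the (finite) product of the `c_p` over any finite set of places of `ℤ` containing
the bad ones (`c_p = 1` at the good places). [folklore] -/
theorem tamagawaProduct_eq_prod (s : Finset (HeightOneSpectrum ℤ))
    (hs : ∀ v, ¬ W.HasGoodReductionAt v → v ∈ s) :
    W.tamagawaProduct = ∏ v ∈ s,
      (haveI := Fact.mk (primesEquiv v).2
       (W.baseChange ℚ_[primesEquiv v]).localTamagawaNumber ℤ_[primesEquiv v]) := by
  rw [tamagawaProduct_eq_finprod_int]
  refine finprod_eq_prod_of_mulSupport_subset _ fun v hv => ?_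
  rw [Finset.mem_coe]
  exact hs v fun hgood => hv (localTamagawaNumber_padic_eq_one_of_hasGoodReductionAt W v hgood)

/-- **[PastenShimura2024, proof of Cor. 16.3], the inequality
`Tam(E) ≤ 4^{#bad} · ∏_{v mult} ord_v(Δ_min)`** over a finite set `s` of places of `ℤ`
containing the bad ones: `Tam(E) = ∏_{v ∈ s} c_v ≤ ∏_{v ∈ s} 4 · (ord_v(Δ_min) or 1)`.
[cite: PastenShimura2024, proof of Corollary 16.3] -/
theorem tamagawaProduct_le_prod (s : Finset (HeightOneSpectrum ℤ))
    (hs : ∀ v, ¬ W.HasGoodReductionAt v → v ∈ s) :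
    W.tamagawaProduct ≤ 4 ^ s.card *
      ∏ v ∈ s, (if W.HasMultiplicativeReductionAt v then W.ordMinimalDiscriminant v else 1) := by
  rw [tamagawaProduct_eq_prod W s hs, Finset.pow_card_mul_prod]
  exact Finset.prod_le_prod' fun v _ => localTamagawaNumber_padic_le_four_mul W v

omit [W.IsElliptic] in
/-- The product `∏_{v ∈ s} (ord_v(Δ_min) or 1)` over a finite set of places containing the bad
ones is the `finprod` of `ord_v(Δ_min)` over the places of multiplicative reduction appearing in
`pasten_cor_16_2` (a place of multiplicative reduction is bad). [folklore] -/
theorem prod_ite_eq_finprod (s : Finset (HeightOneSpectrum ℤ))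
    (hs : ∀ v, ¬ W.HasGoodReductionAt v → v ∈ s) :
    (∏ v ∈ s, (if W.HasMultiplicativeReductionAt v then W.ordMinimalDiscriminant v else 1)) =
      ∏ᶠ v ∈ {v : HeightOneSpectrum ℤ | W.HasMultiplicativeReductionAt v},
        W.ordMinimalDiscriminant v := by
  rw [← Finset.prod_filter]
  symm
  refine finprod_cond_eq_prod_of_cond_iff _ fun {v} _ => ?_
  simp only [Set.mem_setOf_eq, Finset.mem_filter]
  exact ⟨fun hm => ⟨hs v hm.not_hasGoodReductionAt, hm⟩, fun h => h.2⟩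

/-- **Corollary 16.3, the arithmetic half** [PastenShimura2024, proof of Cor. 16.3]:
`Tam(E) ≤ 4^{ω(N_E)} · ∏_{p ∣ N_E^*} v_p(Δ_E)` for every elliptic curve `E/ℚ`, where the product
runs over the primes of multiplicative reduction (`c_p ≤ 4` at additive and non-split primes,
`c_p = v_p(Δ_E)` at split ones, `c_p = 1` at good ones, and the bad primes divide `N_E`).
[cite: PastenShimura2024, proof of Corollary 16.3] -/
theorem tamagawaProduct_le_four_pow_mul_finprod :
    W.tamagawaProduct ≤ 4 ^ (W.conductorNorm ℤ).primeFactors.card *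
      ∏ᶠ v ∈ {v : HeightOneSpectrum ℤ | W.HasMultiplicativeReductionAt v},
        W.ordMinimalDiscriminant v := by
  have hfin : (W.badPlaces ℤ).Finite := W.finite_badPlaces_holds ℤ
  have hs : ∀ v, ¬ W.HasGoodReductionAt v → v ∈ hfin.toFinset := fun v hv => by
    rw [Set.Finite.mem_toFinset, mem_badPlaces_iff]
    exact hv
  have hcard : hfin.toFinset.card ≤ (W.conductorNorm ℤ).primeFactors.card := by
    refine Finset.card_le_card_of_injOn (fun v => natGenerator v) (fun v hv => ?_) ?_
    · rw [Finset.mem_coe, Set.Finite.mem_toFinset, mem_badPlaces_iff] at hv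
      exact natGenerator_mem_primeFactors_conductorNorm W v hv
    · intro v _ w _ hvw
      exact (primesEquiv (R := ℤ)).injective (Subtype.ext hvw)
  calc W.tamagawaProduct
      ≤ 4 ^ hfin.toFinset.card * ∏ v ∈ hfin.toFinset,
          (if W.HasMultiplicativeReductionAt v then W.ordMinimalDiscriminant v else 1) :=
        tamagawaProduct_le_prod W _ hs
    _ ≤ _ := by
        rw [prod_ite_eq_finprod W _ hs]
        exact Nat.mul_le_mul_right _ (Nat.pow_le_pow_right (by norm_num) hcard)

end Places

/-! ### Bounded conductor: finitely many curves (Shafarevich) -/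

/-- **Absorbing the exceptions of Corollary 16.3 into the constant** (the passage from
[PastenShimura2024, Cor. 16.3] "for all but finitely many `E`" to Thm. 1.15): the Tamagawa
products of the elliptic curves over `ℚ` of conductor `< N₀` are bounded. The bad places of such
a curve lie over primes `p ∣ N_E`, `p < N₀` (Silverman *ATAEC* IV.10.2(a)); by **Shafarevich's
theorem** (Silverman *AEC* IX.6.1, `shafarevich_finite_goodReductionOutside_holds`) these curves
fall into finitely many `ℚ`-isomorphism classes of Weierstrass models, and `Tam` is an
isomorphism invariant (`tamagawaProduct_variableChange_eq`).
[cite: SilvermanAEC2009, Thm. IX.6.1] -/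
theorem exists_tamagawaProduct_le_of_conductorNorm_lt (N₀ : ℕ) :
    ∃ K₁ : ℝ, 0 ≤ K₁ ∧ ∀ (W : WeierstrassCurve ℚ) [W.IsElliptic],
      W.conductorNorm ℤ < N₀ → (W.tamagawaProduct : ℝ) ≤ K₁ := by
  -- the finite set of places of `𝓞 ℚ` above the primes `< N₀`
  set S₀ : Set (HeightOneSpectrum (𝓞 ℚ)) :=
    (fun w : HeightOneSpectrum (𝓞 ℚ) => (primesEquiv w : ℕ)) ⁻¹' Set.Iio N₀ with hS₀
  have hS₀fin : S₀.Finite :=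
    (Set.finite_Iio N₀).preimage fun w _ w' _ h => primesEquiv.injective (Subtype.ext h)
  obtain ⟨F, hF⟩ := WeierstrassCurve.shafarevich_finite_goodReductionOutside_holds ℚ S₀ hS₀fin
  refine ⟨∑ X ∈ F, (X.tamagawaProduct : ℝ), Finset.sum_nonneg fun _ _ => Nat.cast_nonneg _, ?_⟩
  intro W _ hN
  have hbad : W.badPlaces (𝓞 ℚ) ⊆ S₀ := by
    intro w hw
    rw [mem_badPlaces_iff] at hw
    show (primesEquiv w : ℕ) < N₀
    -- descend to the place of `ℤ` below the same prime
    have hfw : W.conductorExponent w ≠ 0 := fun h0 =>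
      hw ((conductorExponent_eq_zero_iff_holds w W).mp h0)
    rw [conductorExponent_ringOfIntegers_eq W w] at hfw
    have hmem := natGenerator_mem_primeFactors_conductorNorm W
      ((primesEquiv (R := ℤ)).symm (primesEquiv w)) fun hg =>
        hfw ((conductorExponent_eq_zero_iff_holds _ W).mpr hg)
    have hgen : natGenerator ((primesEquiv (R := ℤ)).symm (primesEquiv w)) =
        (primesEquiv w : ℕ) :=
      congrArg Subtype.val ((primesEquiv (R := ℤ)).apply_symm_apply (primesEquiv w))
    rw [hgen] at hmem
    exact lt_of_le_of_lt (Nat.le_of_mem_primeFactors hmem) hN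
  obtain ⟨C, hC⟩ := hF W hbad
  rw [← tamagawaProduct_variableChange_eq W C]
  exact Finset.single_le_sum (f := fun X : WeierstrassCurve ℚ => (X.tamagawaProduct : ℝ))
    (fun X _ => Nat.cast_nonneg _) hC

/-! ### Theorem 1.15 from Corollary 16.2 -/

/-- **[PastenShimura2024, Theorem 1.15] from [PastenShimura2024, Corollary 16.2]** (the printed
proof: Cor. 16.3 — "This follows from Corollary 16.2 … `Tam(E) ≤ 4^{ω(N_E)} ∏_{p ∣ N_E^*} v_p(Δ_E)
≪_ε N_E^ε ∏_{p ∣ N_E^*} v_p(Δ_E)`" — together with the finiteness of the set of `E/ℚ` of bounded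
conductor up to isomorphism, which absorbs the finitely many exceptions into `K_{S,ε}`).
Given `S`, `ε > 0`: Corollary 16.2 with `ε/2` gives `N₀`; for `N_E ≥ N₀`,
`Tam(E) ≤ 4^{ω(N_E)} ∏_{v mult} ord_v(Δ_min) < C_{ε/2} N_E^{ε/2} · N_E^{11/2+ε/2}`
(`tamagawaProduct_le_four_pow_mul_finprod` and the elementary `4^{ω(N)} ≤ C_δ N^δ`, inline); for
`N_E < N₀`, `Tam(E) ≤ K₁` (`exists_tamagawaProduct_le_of_conductorNorm_lt`); and
`K_{S,ε} := K₁ + C_{ε/2} + 1` works since `N_E ≥ 1`. Once `pasten_cor_16_2` is discharged this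
yields `pasten_thm_1_15_holds`. [cite: PastenShimura2024, Theorem 1.15 and Corollary 16.3] -/
theorem pasten_thm_1_15_of_cor_16_2 (h : pasten_cor_16_2) : pasten_thm_1_15 := by
  intro S ε hε
  have hε2 : 0 < ε / 2 := half_pos hε
  obtain ⟨N₀, hN₀⟩ := h S (ε / 2) hε2
  -- `4^{ω(n)} ≤ C · n^{ε/2}` for `n ≥ 1`: primes `p ≥ T = ⌈4^{2/ε}⌉` have `p^{ε/2} ≥ 4` and their
  -- product divides `n`; the primes `< T` number at most `T`.
  obtain ⟨C, hC, hCle⟩ : ∃ C : ℝ, 0 < C ∧ ∀ n : ℕ, n ≠ 0 →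
      (4 : ℝ) ^ n.primeFactors.card ≤ C * (n : ℝ) ^ (ε / 2) := by
    generalize ε / 2 = δ at hε2
    obtain ⟨T, hT⟩ : ∃ T : ℕ, ∀ p : ℕ, T ≤ p → (4 : ℝ) ≤ (p : ℝ) ^ δ := by
      refine ⟨⌈(4 : ℝ) ^ (1 / δ)⌉₊, fun p hp => ?_⟩
      have h1 : (4 : ℝ) ^ (1 / δ) ≤ p := (Nat.le_ceil _).trans (by exact_mod_cast hp)
      calc (4 : ℝ) = ((4 : ℝ) ^ (1 / δ)) ^ δ := by
            rw [← Real.rpow_mul (by norm_num), one_div_mul_cancel hε2.ne', Real.rpow_one]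
        _ ≤ (p : ℝ) ^ δ := Real.rpow_le_rpow (by positivity) h1 hε2.le
    refine ⟨4 ^ T, by positivity, fun n hn => ?_⟩
    set P := n.primeFactors with hP
    have hsplit : (P.filter (· < T)).card + (P.filter (fun p => ¬ p < T)).card = P.card :=
      Finset.card_filter_add_card_filter_not _
    have hsmall : (4 : ℝ) ^ (P.filter (· < T)).card ≤ (4 : ℝ) ^ T := by
      refine pow_le_pow_right₀ (by norm_num) ?_
      calc (P.filter (· < T)).card ≤ (Finset.range T).card :=
            Finset.card_le_card fun p hp => by
              rw [Finset.mem_filter] at hp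
              exact Finset.mem_range.2 hp.2
        _ = T := Finset.card_range T
    have hlarge : (4 : ℝ) ^ (P.filter (fun p => ¬ p < T)).card ≤ (n : ℝ) ^ δ := by
      calc (4 : ℝ) ^ (P.filter (fun p => ¬ p < T)).card
          = ∏ _p ∈ P.filter (fun p => ¬ p < T), (4 : ℝ) := by rw [Finset.prod_const]
        _ ≤ ∏ p ∈ P.filter (fun p => ¬ p < T), (p : ℝ) ^ δ := by
            refine Finset.prod_le_prod (fun _ _ => by norm_num) fun p hp => ?_
            rw [Finset.mem_filter, not_lt] at hp
            exact hT p hp.2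
        _ = (((∏ p ∈ P.filter (fun p => ¬ p < T), p : ℕ)) : ℝ) ^ δ := by
            rw [Real.finsetProd_rpow _ _ (fun p _ => by positivity), Nat.cast_prod]
        _ ≤ (n : ℝ) ^ δ := by
            refine Real.rpow_le_rpow (by positivity) ?_ hε2.le
            exact_mod_cast Nat.le_of_dvd (Nat.pos_of_ne_zero hn)
              ((Finset.prod_dvd_prod_of_subset _ _ _ (Finset.filter_subset _ _)).trans
                (Nat.prod_primeFactors_dvd n))
    calc (4 : ℝ) ^ P.card
        = (4 : ℝ) ^ (P.filter (· < T)).card * (4 : ℝ) ^ (P.filter (fun p => ¬ p < T)).card := by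
          rw [← pow_add, hsplit]
      _ ≤ (4 : ℝ) ^ T * (n : ℝ) ^ δ := mul_le_mul hsmall hlarge (by positivity) (by positivity)
  obtain ⟨K₁, hK₁, hsmall⟩ := exists_tamagawaProduct_le_of_conductorNorm_lt N₀
  refine ⟨K₁ + C + 1, by positivity, ?_⟩
  intro W _ hS hmult
  have hNpos : 0 < W.conductorNorm ℤ := W.conductorNorm_pos_holds
  have hN1 : (1 : ℝ) ≤ (W.conductorNorm ℤ : ℝ) := by exact_mod_cast hNpos
  have hNpos' : (0 : ℝ) < (W.conductorNorm ℤ : ℝ) := by exact_mod_cast hNpos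
  have hrpow1 : (1 : ℝ) ≤ (W.conductorNorm ℤ : ℝ) ^ (11 / 2 + ε : ℝ) :=
    Real.one_le_rpow hN1 (by positivity)
  by_cases hlt : W.conductorNorm ℤ < N₀
  · -- small conductor: `Tam(E) ≤ K₁ < K ≤ K · N^{11/2+ε}`
    calc (W.tamagawaProduct : ℝ) ≤ K₁ := hsmall W hlt
      _ < (K₁ + C + 1) * 1 := by linarith
      _ ≤ (K₁ + C + 1) * (W.conductorNorm ℤ : ℝ) ^ (11 / 2 + ε : ℝ) :=
          mul_le_mul_of_nonneg_left hrpow1 (by positivity)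
  · -- large conductor: Cor. 16.2 and the local estimate
    have hP := hN₀ W hS hmult (not_lt.mp hlt)
    have hTam : (W.tamagawaProduct : ℝ) ≤ (4 : ℝ) ^ (W.conductorNorm ℤ).primeFactors.card *
        ((∏ᶠ v ∈ {v : HeightOneSpectrum ℤ | W.HasMultiplicativeReductionAt v},
          W.ordMinimalDiscriminant v : ℕ) : ℝ) := by
      exact_mod_cast tamagawaProduct_le_four_pow_mul_finprod W
    have hω := hCle (W.conductorNorm ℤ) hNpos.ne'
    have h4pos : (0 : ℝ) < (4 : ℝ) ^ (W.conductorNorm ℤ).primeFactors.card := by positivity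
    calc (W.tamagawaProduct : ℝ)
        ≤ (4 : ℝ) ^ (W.conductorNorm ℤ).primeFactors.card *
          ((∏ᶠ v ∈ {v : HeightOneSpectrum ℤ | W.HasMultiplicativeReductionAt v},
            W.ordMinimalDiscriminant v : ℕ) : ℝ) := hTam
      _ < (4 : ℝ) ^ (W.conductorNorm ℤ).primeFactors.card *
          (W.conductorNorm ℤ : ℝ) ^ (11 / 2 + ε / 2 : ℝ) := mul_lt_mul_of_pos_left hP h4pos
      _ ≤ C * (W.conductorNorm ℤ : ℝ) ^ (ε / 2) *
          (W.conductorNorm ℤ : ℝ) ^ (11 / 2 + ε / 2 : ℝ) :=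
          mul_le_mul_of_nonneg_right hω (Real.rpow_nonneg hNpos'.le _)
      _ = C * (W.conductorNorm ℤ : ℝ) ^ (11 / 2 + ε : ℝ) := by
          rw [mul_assoc, ← Real.rpow_add hNpos']
          congr 2
          ring
      _ ≤ (K₁ + C + 1) * (W.conductorNorm ℤ : ℝ) ^ (11 / 2 + ε : ℝ) := by
          refine mul_le_mul_of_nonneg_right ?_ (Real.rpow_nonneg hNpos'.le _)
          linarith

/-! ### Semistable curves: the product of `pasten_cor_16_2` is the product of `pasten_thm_1_12` -/

section Semistable

variable (W : WeierstrassCurve ℚ) [W.IsElliptic]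

/-- For a semistable `E/ℚ` the quantity `∏_{v mult} ord_v(Δ_min)` of Cor. 16.2 is the product
`∏_{p ∣ N_E} v_p(Δ_E)` of Thm. 1.12 / Thm. 16.5: every bad place is multiplicative, the bad
primes are exactly the prime factors of `N_E` (Silverman *ATAEC* IV.10.2(a)), and
`v_p(|Δ_min|) = ord_v(Δ_min)` (`factorization_minimalDiscriminantNorm_holds`). [folklore] -/
theorem finprod_ordMinimalDiscriminant_eq_prod_factorization (hW : W.IsSemistable ℤ) :
    (∏ᶠ v ∈ {v : HeightOneSpectrum ℤ | W.HasMultiplicativeReductionAt v},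
        W.ordMinimalDiscriminant v) =
      ∏ p ∈ (W.conductorNorm ℤ).primeFactors, (W.minimalDiscriminantNorm ℤ).factorization p := by
  have hfin : (W.badPlaces ℤ).Finite := W.finite_badPlaces_holds ℤ
  have hs : ∀ v, v ∈ hfin.toFinset ↔ ¬ W.HasGoodReductionAt v := fun v => by
    rw [Set.Finite.mem_toFinset, mem_badPlaces_iff]
  rw [← prod_ite_eq_finprod W _ fun v hv => (hs v).mpr hv]
  -- on the bad places semistability gives multiplicative reduction, so the `ite` is `ord_v`
  have hite : ∀ v ∈ hfin.toFinset,
      (if W.HasMultiplicativeReductionAt v then W.ordMinimalDiscriminant v else 1) =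
        (W.minimalDiscriminantNorm ℤ).factorization (natGenerator v) := by
    intro v hv
    have hm : W.HasMultiplicativeReductionAt v :=
      (show W.HasGoodReductionAt v ∨ W.HasMultiplicativeReductionAt v from hW v).resolve_left
        ((hs v).mp hv)
    rw [if_pos hm]
    exact (factorization_minimalDiscriminantNorm_holds W v).symm
  have hinj : Set.InjOn (fun v : HeightOneSpectrum ℤ => natGenerator v) ↑hfin.toFinset :=
    fun v _ w _ h => (primesEquiv (R := ℤ)).injective (Subtype.ext h)
  rw [Finset.prod_congr rfl hite, ← image_natGenerator_eq_primeFactors_conductorNorm W _ hs,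
    Finset.prod_image hinj]

end Semistable

end Literature.NumberTheory.EllipticCurves

end
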